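import Summits.ResolutionOfSingularities.ResolutionOfSingularities.Theorems.LossEntryW25
import HarnessLib

/-!
# LossEntryW26 — decomp-res lens-3 g29 «LossEntryWalk», landing part 26 (slice 18): END′ — a STAYING move of a
one-wall tail state points at the in-wall root

Residual `stmt-ResolutionOfSingularities-27367`.  Imports part 25 only (tree + `LossEntryW25`); independent of parts
12–24.  Companion of the wall-state pencil law (`LossEntryW25`): there the move LEAVES the wall and in-wall purity
propagates; here the move STAYS on the wall (`b_u(a) = 0`, the proximity repeat that ends the loss chain) and the
conclusion is that the direction of the move is FORCED to be the in-wall root: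

* `b_eq_root_of_wall_pure_stays` — one-wall state `u` (boundary `M·e_a`, shade `s ≥ 1`, order `s+M > q`), chart
  `b ≠ a`, shade plateau, `b_u(a) = 0`, in-wall slice of the lowest layer `= φ₀·(u_c − μ u_b)^s` with `φ₀ ≠ 0`
  ⟹ `b_u(c) = μ`.

Proof: by `ConeCut.cone_of_plateau` the residual form `R = L(u + b_u)` (`L` the `u_b`-dehomogenised lowest layer) is a
form of degree `s ≥ 1`, so its constant term `L(b_u)` vanishes (`coeff_zero_translate`); since `b_u(a) = 0` only the
in-wall monomials of `L` survive the evaluation, and through the in-wall slice `L(b_u) = φ₀·(b_u(c) − μ)^s`.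
This is the input (END′) of NODE-g29 §3ter: at the repeat closing the chain the translation parameter `τ = b_{w+1}(l′)`
used by `LossEpisode.runBeta_lt_wallOrd_of_repeat` IS the propagated in-wall root.  Tree tools only; complete proofs,
standard axioms.

(Sources: Hauser2010 §F; HauserPerlega2019 §2; CossartJannsenSaito2020 Ch. 8; Moh1987; Perlega2022.)
-/

open MvPolynomial Finset
open Literature.AlgebraicGeometry.Resolution
open Literature.AlgebraicGeometry.Resolution.Hauser2010
open Literature.AlgebraicGeometry.Resolution.PointBlowup
open Summit.ResolutionOfSingularities.ResolutionOfSingularities.Theorems.TightDefectClasses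
open Summit.ResolutionOfSingularities.ResolutionOfSingularities.Theorems.TightDefectStrongWalks
open Summit.ResolutionOfSingularities.ResolutionOfSingularities.Theorems.ItineraryCutClasses
open Summit.ResolutionOfSingularities.ResolutionOfSingularities.Theorems.BoundaryLedger
open Summit.ResolutionOfSingularities.ResolutionOfSingularities.Theorems.ProximityCut
open Summit.ResolutionOfSingularities.ResolutionOfSingularities.Theorems.ConeCut
open Summit.ResolutionOfSingularities.ResolutionOfSingularities.Theorems.LossExitCone

namespace Summit.ResolutionOfSingularities.ResolutionOfSingularities.Theorems.LossPolygon

section WallStayRoot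

variable {K : Type} [Field K] [DecidableEq K] {q : ℕ} {s₀ : State (Fin 3) K}

omit [DecidableEq K] in
/-- The constant coefficient of a translate is the value at the translation vector. [folklore] -/
theorem coeff_zero_translate (b : Fin 3 → K) (G : MvPolynomial (Fin 3) K) :
    coeff 0 (PointBlowup.translate b G) = eval b G := by
  classical
  induction G using MvPolynomial.induction_on with
  | C a =>
    unfold PointBlowup.translate
    rw [aeval_C, algebraMap_eq, coeff_zero_C, eval_C]
  | add f g hf hg =>
    unfold PointBlowup.translate at *
    rw [map_add, coeff_add, hf, hg, map_add]
  | mul_X p i hp =>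
    have h : PointBlowup.translate b (p * X i) =
        PointBlowup.translate b p * X i + C (b i) * PointBlowup.translate b p := by
      unfold PointBlowup.translate
      rw [map_mul, aeval_X]
      ring
    rw [h, coeff_add, coeff_mul_X', if_neg (by simp), zero_add, coeff_C_mul, hp, map_mul, eval_X, mul_comm]

omit [DecidableEq K] in
/-- The support of the pure power `(u_c − μ u_b)^n`: degree `n`, no `u_a`. [folklore] -/
theorem degree_eq_of_mem_support_pure {a b c : Fin 3} (hab : a ≠ b) (hac : a ≠ c) (μ : K) (n : ℕ)
    (E : Fin 3 →₀ ℕ) (hE : E ∈ ((X c - C μ * X b) ^ n : MvPolynomial (Fin 3) K).support) :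
    E.degree = n ∧ E a = 0 := by
  have hhom : ((X c - C μ * X b) ^ n : MvPolynomial (Fin 3) K).IsHomogeneous n := by
    have h1 : (X c - C μ * X b : MvPolynomial (Fin 3) K).IsHomogeneous 1 :=
      (isHomogeneous_X K c).sub (by simpa using (isHomogeneous_C (Fin 3) μ).mul (isHomogeneous_X K b))
    simpa using h1.pow n
  refine ⟨?_, ?_⟩
  · by_contra h
    exact (MvPolynomial.mem_support_iff.mp hE) (hhom.coeff_eq_zero h)
  · by_contra h
    exact (MvPolynomial.mem_support_iff.mp hE) (coeff_pure_pow_eq_zero (Ne.symm hab) hac μ n E h)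

/-- **END′ — AT A STAYING MOVE THE DIRECTION IS THE IN-WALL ROOT (PROVED).**  At a one-wall state `u` (boundary
`M·e_a`, shade `s ≥ 1`, order `s + M > q`) moving in the chart `b ≠ a` with a shade plateau and STAYING on the wall
(`b_u(a) = 0`): if the in-wall slice of the lowest layer is the pure power `φ₀·(u_c − μ u_b)^s`, `φ₀ ≠ 0`, then the
direction of the move is the root: `b_u(c) = μ`.  (The residual form `R = L(u + b_u)` is a form of degree `s ≥ 1`
by `cone_of_plateau`, so its constant term `L(b_u) = φ₀·(b_u(c) − μ)^s` vanishes.) [new] [folklore] -/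
theorem b_eq_root_of_wall_pure_stays (hroot : IsRoot q s₀) (W : ForcedWalk q s₀) (u : ℕ) {a b c : Fin 3}
    (hab : a ≠ b) (hac : a ≠ c) (hbc : b ≠ c) (hj : W.j u = b) {M s : ℕ} (hs1 : 1 ≤ s)
    (hr : (W.st u).r = Finsupp.single a M) (hsh : (W.st u).shade = (s : ℕ∞))
    (hplat : (W.st (u + 1)).shade = (W.st u).shade) (hq : q < s + M) (hga : W.b u a = 0) {φ₀ μ : K}
    (hφ₀ : φ₀ ≠ 0)
    (hwall : ∀ E : Fin 3 →₀ ℕ, E.degree = s → E a = 0 →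
      coeff ((W.st u).r + E) (W.st u).F = φ₀ * coeff E ((X c - C μ * X b) ^ s)) :
    W.b u c = μ := by
  classical
  obtain ⟨o, ho, -⟩ := walk_nat hroot W u
  obtain ⟨n, hn, hon⟩ := order_eq_shade_add_degree hroot W u ho
  have hns : n = s := by
    have h := hsh
    rw [hn] at h
    exact_mod_cast h
  subst hns
  have hrdeg : (W.st u).r.degree = M := by rw [hr, Finsupp.degree_single]
  rw [hrdeg] at hon
  subst hon
  have hqo : q < n + M := hq
  have hcone := (cone_of_plateau hroot W u ho hqo hplat hn).1
  -- the constant term of the residual form vanishes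
  have h0 : coeff 0 (resForm W u (n + M)) = 0 :=
    hcone.coeff_eq_zero (by rw [map_zero]; omega)
  unfold resForm at h0
  rw [coeff_zero_translate, hj] at h0
  -- evaluate the residual layer at `b_u` through the in-wall slice
  set P : MvPolynomial (Fin 3) K := (X c - C μ * X b) ^ n with hP
  set g : Fin 3 → K := W.b u with hg
  set A := ((W.st u).F.support.filter fun d => d.degree = n + M).filter (fun d => d a = M) with hA
  have hwr := walk_r hroot W u
  have hev : eval g (resLayer b (W.st u) (n + M)) = ∑ d ∈ A, coeff d (W.st u).F * g c ^ (d c) := by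
    unfold resLayer
    rw [map_sum]
    conv_rhs => rw [hA, Finset.sum_filter]
    refine Finset.sum_congr rfl fun d hd => ?_
    have hdF : d ∈ (W.st u).F.support := (Finset.mem_filter.mp hd).1
    have hrd : (W.st u).r ≤ d := hwr d hdF
    have hMd : M ≤ d a := by have := hrd a; rwa [hr, Finsupp.single_eq_same] at this
    rw [eval_monomial, Finsupp.prod_fintype _ _ (fun i => pow_zero _), prod_univ_fin3 hab hac hbc,
      update_apply', if_neg hab, update_apply', if_pos rfl, update_apply', if_neg (Ne.symm hbc),
      Finsupp.tsub_apply, Finsupp.tsub_apply, hr, Finsupp.single_eq_same, Finsupp.single_eq_of_ne hac.symm,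
      Nat.sub_zero, pow_zero, mul_one]
    by_cases hda : d a = M
    · rw [if_pos hda, hda, Nat.sub_self, pow_zero, one_mul]
    · rw [if_neg hda, hga, zero_pow (by omega), zero_mul, mul_zero]
  -- the in-wall slice rewrites the sum through `P`
  set f : (Fin 3 →₀ ℕ) → K := fun E => coeff E P * g c ^ (E c) with hf
  have hterm : ∀ d ∈ A, coeff d (W.st u).F * g c ^ (d c) = φ₀ * f (d - (W.st u).r) := by
    intro d hd
    obtain ⟨hd1, hda⟩ := Finset.mem_filter.mp hd
    obtain ⟨hdF, hdeg⟩ := Finset.mem_filter.mp hd1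
    have hrd : (W.st u).r ≤ d := hwr d hdF
    have hE : d = (W.st u).r + (d - (W.st u).r) := (add_tsub_cancel_of_le hrd).symm
    have hEdeg : (d - (W.st u).r).degree = n := by
      have h := congrArg Finsupp.degree hE
      rw [map_add, hrdeg, hdeg] at h
      omega
    have hEa : (d - (W.st u).r) a = 0 := by
      rw [Finsupp.tsub_apply, hr, Finsupp.single_eq_same, hda, Nat.sub_self]
    have hEc : (d - (W.st u).r) c = d c := by
      rw [Finsupp.tsub_apply, hr, Finsupp.single_eq_of_ne hac.symm, Nat.sub_zero]
    rw [hf]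
    simp only
    rw [hEc, ← mul_assoc, ← hwall _ hEdeg hEa, ← hE]
  rw [hev, Finset.sum_congr rfl hterm, ← Finset.mul_sum] at h0
  -- reindex: `d ↦ d − r` is injective on `A`, and its image carries the whole support of `P`
  have hinj : Set.InjOn (fun d => d - (W.st u).r) A := by
    intro d hd d' hd' h
    have hrd : (W.st u).r ≤ d := hwr d (Finset.mem_filter.mp (Finset.mem_filter.mp hd).1).1
    have hrd' : (W.st u).r ≤ d' := hwr d' (Finset.mem_filter.mp (Finset.mem_filter.mp hd').1).1
    have := congrArg (fun E => (W.st u).r + E) h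
    simp only at this
    rwa [add_tsub_cancel_of_le hrd, add_tsub_cancel_of_le hrd'] at this
  rw [← Finset.sum_image hinj] at h0
  set A' := A.image (fun d => d - (W.st u).r) with hA'
  have hsum : ∑ E ∈ A', f E = ∑ E ∈ P.support, f E := by
    have h1 : ∑ E ∈ A', f E = ∑ E ∈ A' ∪ P.support, f E := by
      refine Finset.sum_subset Finset.subset_union_left fun E hEU hEA => ?_
      rw [hf]
      simp only
      rcases Finset.mem_union.mp hEU with h | hEP
      · exact absurd h hEA
      · exfalso
        apply hEA
        obtain ⟨hEdeg, hEa⟩ := degree_eq_of_mem_support_pure hab hac μ n E hEP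
        have hcoef : coeff ((W.st u).r + E) (W.st u).F ≠ 0 := by
          rw [hwall E hEdeg hEa]
          exact mul_ne_zero hφ₀ (MvPolynomial.mem_support_iff.mp hEP)
        refine Finset.mem_image.mpr ⟨(W.st u).r + E, ?_, add_tsub_cancel_left _ _⟩
        refine Finset.mem_filter.mpr ⟨Finset.mem_filter.mpr ⟨MvPolynomial.mem_support_iff.mpr hcoef, ?_⟩, ?_⟩
        · rw [map_add, hrdeg, hEdeg, add_comm]
        · rw [Finsupp.add_apply, hr, Finsupp.single_eq_same, hEa, add_zero]
    have h2 : ∑ E ∈ P.support, f E = ∑ E ∈ A' ∪ P.support, f E := by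
      refine Finset.sum_subset Finset.subset_union_right fun E _ hEP => ?_
      rw [hf]
      simp only
      rw [MvPolynomial.notMem_support_iff.mp hEP, zero_mul]
    rw [h1, h2]
  rw [hsum] at h0
  -- the last sum is the value of `P` at `(·, 1, g c)`
  have hval : ∑ E ∈ P.support, f E = (g c - μ) ^ n := by
    have h := (eval_eq' (fun l => if l = c then g c else 1) P).symm
    rw [hP, map_pow, map_sub, map_mul, eval_X, eval_C, eval_X, if_pos rfl, if_neg hbc, mul_one] at h
    rw [← hP] at h
    rw [← h]
    refine Finset.sum_congr rfl fun E _ => ?_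
    rw [hf]
    simp only
    rw [prod_univ_fin3 hab hac hbc, if_neg hac, if_neg hbc, if_pos rfl, one_pow, one_pow, one_mul, one_mul]
  rw [hval] at h0
  have := (mul_eq_zero.mp h0).resolve_left hφ₀
  exact sub_eq_zero.mp ((pow_eq_zero_iff (by omega)).mp this)

end WallStayRoot

end Summit.ResolutionOfSingularities.ResolutionOfSingularities.Theorems.LossPolygon
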